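import Literature.MathematicalPhysics.QuantumFieldTheory.Balaban1983to89.Node00.Record13CarriersB8SubBP2DCoPH
import Summits.QuantumFields.YangMills.Theorems.BalabanUVNodesN05SubBP2DSlotGammaPrime

/-!
# BalabanUVNodes ∕ N05 ([B8], `Dag.B8_main`) AT THE STAGE-13 RECORD OF RECORD — PRINT'S BACKGROUND (v1.7 key `SepCoPH`), «P₂D» PIN (the δ₂ group over the (1.5)-OBEYING
# admissible sub-index `IdxB8SubD`, Proposition 7 in the repaired currency with print's tower map PINNED, SC-binding `upOfRecord₅CSC`): the SLOT CLOSER at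
# `Node00.IsRecordOfRecord₁₃CSepCoPHSB8subBP₂D` (+ same-datum `₁₃CSepCoPH` companion) in slot-currency (§1) and ∃λ-currency (§3), and N05 in ∃-currency FED BY THE
# RE-KEYED «P₂D» KNIT OF RECORD (§2) — Proposition 7 SERVED, display = `p5e p5u p6` + the (1.5)-keyed [4]-type sockets only

Track A of `YM-PLAN.md` (cell `pub-ymgap`, HUMAN RULING D-0062 ∕ D-0149 width seats), node **N05** = [Balaban1985RegularSpaces] Lemma 1, Thm 2, Prop 3, Thm 4, Props 5–7,
Thm 8; width seat `pub-ymgap-dag-n05-w4` (g3), 2026-08-28, key item K1⁸ `StabilityBRunRowsAtRecordR13SepCoPH` (dag-lead KEY MAP v1.65; `--supports`, helper; count-neutral).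
«P₂D» TWIN (token map «`SubBP₂C ↦ SubBP₂D`; SC-binding `upOfRecord₅CSC … (c₇OfRecord θ₃)` UNCHANGED; every class-wide [4]-type binder gains dag-n05-c's (1.5) corner letter
`(∀ l, l < i.k → ∀ z ∈ i.Λs i.k l, ((θ.L : ℤ) ^ l) • z ∈ B8ConstraintBonds.Lam θ.L i.Ω l) →`», dag-n05-d g12 DESIGN WORD «P₂D» (cell bus 2026-08-28 07:54Z) ∕ dag-lead DEDUP-376
«records∕storeys re-key (n05-w1∕w4)») of this seat's `Thm/BalabanUVNodesN05AtRecord13SubBP2CSepCoPH` (p610956 + v1.1 p615359), on width seat `pub-ymgap-dag-n05-w1` g2's SC-bound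
P₂D record `Node00/Record13CarriersB8SubBP2DCoPH` (`IsRecordOfRecord₁₃CSepCoPHSB8subBP₂D`, `Stage13HParams.pinB8SubBP₂D`, companion ∕ main-iff ∕ slot faces) over the pin
`Node00/CarriersB8SubBP2D` (p617069: slot `B8LeafOfRecordSubBP₂D` = `B8LeafRSC` at `c₇OfRecord θ = 530·D·L²` over `IdxB8SubD θ` = the members of `IdxB8SubC θ` obeying print's (1.5)
«Λ_j = Ω_j^{(j)} ∖ Ω_{j+1}^{(j)}» in dag-n05-c's corner reading `LamTop` (p613464), family `famB8OfRecordSubBP₂D = zdGF3HP₂ ∘ (·.1.1.1.1)`, axial map `toAxialTowerResid … (·.1.1.1)`), fed BY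
NAME by dag-n05-d g12's re-keyed slot theorem `Thm/BalabanUVNodesN05SubBP2DSlotGammaPrime.b8LeafOfRecordSubBP₂D_cutSubB_of_knit_lettersSrc_γ'` (p618522; = the knit
`…SubBP2DKnitGammaPrime.b8LeafRSC_P2D_of_knit_lettersSrc_γ'` through the pin's `b8LeafOfRecordSubBP₂D_cutSubB_iff`).  WHY THE RE-KEY: the «P₂C» knits' [4]-letters binders
over `Ω₀ = ℤᵈ ∧ IdxB8LawsB ∧ DomainSeq` are UNSATISFIABLE as typed (dag-n05-w1 g2's certificate `B8SockLettersRDIdxB8LawsBVacuity`, p613168) — so §2 of p610956 is VACUOUS AS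
TYPED; §2 below displays the binders over the (1.5)-obeying class instead (the `i⋆` obstruction excluded by construction; satisfiability class-wise is N06's business — no positive
A6 witness at m ≥ 1 is claimed here).

* §1 `exists_isRecordOfRecord₁₃CSepCoPHSB8subBP₂D_b8_of_leaf` — THE SLOT CLOSER: ADMISSIBLE `θ : Stage13HParams F N` WITH v1.7 PROVISOS `h`, a residual [B8] layer `λ` and a proof of
  the P₂D slot `B8LeafOfRecordSubBP₂D θ.toStage3Params λ` give, for every window `γw ∈ ]0, θ.γ]`, worlds `w w′`: `IsRecordOfRecord₁₃CSepCoPHSB8subBP₂D F N (datumOfRecord₁₃SepCoPH θ h) w`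
  with its SC-binding DISPLAYED, EVERY run's `b8` leaf and `Dag.B8_main (leavesP w P)`, and the same-datum companion `IsRecordOfRecord₁₃CSepCoPH … w′` (leaves equal off `b8`);
  `b8_main_at_…_of_forall_leaf` (∀-currency).
* §2 ★ `exists_isRecordOfRecord₁₃CSepCoPHSB8subBP₂D_b8_of_knit_lettersSrc_γ'` — §1 FED BY THE RE-KEYED KNIT at the CUT LAYER `λ.cutSubB J lan c₁`: its inputs AT `θ.toStage3Params`,
  BINDER TEXTS VERBATIM from p618522 (record constants with Theorem 8's layer equations and the sourced free-constant guard; [4]'s letters `SLet` ∕ `SLetUB`, the sourceless b9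
  socket of Prop. 3's frame in its both-points Hölder edition `SB9P : SockB9P3H2 …` and the two SOURCED b9 sockets `SH59src` ∕ `SB9srcHP` at the (1.3)–(1.5)-ADMISSIBLE
  `Ω₀ = ℤᵈ` law members — HYPOTHESES; the printed members `p5e p5u` (Prop. 5 at an arbitrary `lan`) and `p6` (Prop. 6 on the record's cube family at `c₁`) DISPLAYED; NO
  `p7` — Proposition 7 is SERVED inside the knit in the repaired currency for print's tower map) ⇒ for every `γw ∈ ]0, θ.γ]`, `∃ w w′` as in §1.  One `exact` (§1 ∘ p618522).
* §3 `exists_isRecordOfRecord₁₃CSepCoPHSB8subBP₂D_b8_of_exists_leaf`, `exists_record_b8_main_of_exists_leaf` — THE SLOT CLOSER IN ∃λ-CURRENCY (the row type «`∃ lam8,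
  B8LeafOfRecordSubBP₂D θ₃ lam8`» = the CONCLUSION SHAPE of dag-n05-d g12's ∃λ theorem (11) `…SubBP2DSlotExistsLawLanGammaPrime.exists_residB8_b8LeafOfRecordSubBP₂D_lawLan_of_lettersSrc_γ'`,
  announced): the by-name adapter any ∃λ supplier plugs into at the CoPH «P₂D» record; NO socket ∕ letters text displayed there.

HONEST FRAMING: kernel bookkeeping by name over n05-w1's record module and n05-d's slot theorem (nothing of either restated); NO estimate; nothing of [Balaban1985RegularSpaces]
asserted — in §1 ∕ §3 the slot (resp. its ∃λ form) is a HYPOTHESIS, in §2 every socket ∕ letters family and `p5e p5u p6` are HYPOTHESES ([4] Thms 3.1–3.3 = N06 content at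
`m ≥ 1`, OPEN; Prop. 6 on the record's cube family = LOCATED-CARRIER; no joint-satisfiability claim); the record is NOT a member of the RS-currency S-class
`IsRecordOfRecord₁₃CSepCoPHS` (n05-w1 LOCATED-SCLASS-CURRENCY) — it is a member of the `b8`-generic class `IsRecordOfRecord₁₃CSepCoPHG` by n05-w1's (d) (announced); Proposition 7
in the repaired currency is WEAKER than print's `2α₂` (declared by the pin, WATCH-P7-CURRENCY-RECORD); count-neutral; **N05 NOT discharged**; K1 NOT claimed; no count claim;
Bałaban AS PRINTED with locators; one finite 𝕋⁴ programme at fixed ε — the Yang–Mills mass gap (Clay) is NOT proved by any of this; R4 closes the conditional finite-𝕋⁴ rung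
`BalabanLadder.UV` only; nothing continuum ∕ ℝ⁴ ∕ OS.  No `sorry`, no new definition, no `instance`, no `notation`.  Unit `pub-ymgap-dag-n05-w4` (g3), 2026-08-28.
[cite: Balaban1985RegularSpaces, Lemma 1 p.79, Thm 2 p.83, Prop. 3 p.87, Thm 4 p.88, Prop. 5 (1.107)–(1.109) p.94, Prop. 6 (1.131)–(1.138) pp.98–99, Prop. 7 (1.144)–(1.145) p.100, (1.3)–(1.5) p.77, Thm 8 (1.146) p.101; Balaban1985BackgroundPropagators, Thm 3.1 p.397, Thm 3.3 p.398 (hypotheses); Balaban1989LargeFieldII, Thm 1 + (0.1) pp.355–356 (the record, bookkeeping)]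
-/

noncomputable section

namespace Summit.QuantumFields.YangMills.BalabanUVNodes.N05AtRecord13SubBP2DSepCoPH

open Literature.MathematicalPhysics.QuantumFieldTheory.Balaban1983to89
open Literature.MathematicalPhysics.QuantumFieldTheory.Balaban1983to89.Node00
open Literature.MathematicalPhysics.QuantumFieldTheory.Balaban1983to89.T4Continuum
open Literature.MathematicalPhysics.QuantumFieldTheory.Balaban1983to89.DagBinding
open Literature.MathematicalPhysics.QuantumFieldTheory.Balaban1983to89.B8IdxB8LawsB (IdxB8LawsB IdxB8SubB)
open Literature.MathematicalPhysics.QuantumFieldTheory.Balaban1983to89.B8LeafModelZd (ZdIdx)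
open Literature.MathematicalPhysics.QuantumFieldTheory.Balaban1983to89.B8LeafModelZd3 (SockB9P3)
open Literature.MathematicalPhysics.QuantumFieldTheory.Balaban1983to89.B9SupplySockB9P3ZdGammaUnivDelta2 (SockB9P3H2)
open Literature.MathematicalPhysics.QuantumFieldTheory.Balaban1983to89.B8LeafModelZd3P (zdGF3P zdGF3HP)
open Literature.MathematicalPhysics.QuantumFieldTheory.Balaban1983to89.B8LeafModelZd3P2 (zdGF3P₂ zdGF3HP₂)
open Literature.MathematicalPhysics.QuantumFieldTheory.Balaban1983to89.B8LeafKnitRSC (B8LeafRSC)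
open Literature.MathematicalPhysics.QuantumFieldTheory.Balaban1983to89.B8Prop7TowerAxialRecord (toAxialTowerResid)
open Literature.MathematicalPhysics.QuantumFieldTheory.Balaban1983to89.B8TowerBondsPrinted (towerBondsP)
open Literature.MathematicalPhysics.QuantumFieldTheory.Balaban1983to89.B8SockLettersRD (SockLettersRD)
open Literature.MathematicalPhysics.QuantumFieldTheory.Balaban1983to89.B8Lemma1NonAbelian (mulCfg blockPairNA)
open Literature.MathematicalPhysics.QuantumFieldTheory.Balaban1983to89.B8LanF146 (LanF146)
open Literature.MathematicalPhysics.QuantumFieldTheory.Balaban1983to89.B8Eq138LandauZd (covLap QT InR138 IsLandau146W)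
open Summit.QuantumFields.YangMills.BalabanUVNodes.N05SubBP2DSlotGammaPrime (b8LeafOfRecordSubBP₂D_cutSubB_of_knit_lettersSrc_γ')
open MatrixLog B7Prop1Explicit B7Prop2Explicit B7Prop1Local B7Eq92Concrete
open B8Ineq130 (tlo thi)
open B8Ineq132 (InAk covDerivFwd)
open B7Eq78Linearization (zdBlocking QprimeIter)
open B8Eq119TwistedAxial (bgT Restr129 InAx)
open B8Eq140Level (SideTouches)
open B8Eq1117Concrete (XSpace)
open B8Prop5ContractionKLevel (Bd2)
open B8LambdaSpaceKLevel (wt)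
open B8Eq184Proof (gaugeExp cfgExp)
open B8Eq146AExpansion (iEta plaqCovDeriv)
open B8Eq143PlaqExpansion (pdiv)
open B7Prop4GeneralLevels (linCovIter)
open B8Eq155JBound (Jcur wsup)
open B8ScaledSupNorm (bondNorm msup Bdd)
open B9Eq340HolderZd (hquot AdmPair)

-- `Site` alone could resolve to the torus sites of `Setup.lean`; re-export the `ℤ^d` sites of `B7Prop1Explicit`.
export B7Prop1Explicit (Site)

/-! ## §1. The slot closer at the v1.7-keyed «P₂D» record (any proof of the P₂D slot ⇒ N05 in ∃-currency at the record of record + companion) -/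

section Slot

variable {F : T4Family} {N : ℕ} [NeZero N]

/-- **THE SLOT CLOSER AT THE RECORD OF RECORD (v1.7 key, «P₂D» pin, SC-binding).**  ADMISSIBLE Stage-13 parameters `θ` WITH the v1.7 provisos `h`, a residual [B8] layer `lam` and a
proof of the P₂D slot `B8LeafOfRecordSubBP₂D θ.toStage3Params lam` give, for every window `γw ∈ ]0, θ.γ]`, worlds `w w′` with: `IsRecordOfRecord₁₃CSepCoPHSB8subBP₂D F N
(datumOfRecord₁₃SepCoPH θ h) w` (binding DISPLAYED: the SC-binding `upOfRecord₅CSC … (c₇OfRecord θ₃)` over the [B8″P₂D]-pinned Co Stage-13 view), EVERY run's `b8` leaf and `Dag.B8_main`,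
and the same-datum companion `IsRecordOfRecord₁₃CSepCoPH … w′` (leaves equal off `b8`).  Pure bookkeeping over `Node00/Record13CarriersB8SubBP2DCoPH`.
[cite: Balaban1985RegularSpaces, Lemma 1 – Thm 8 pp.79–101, Thm 8 (1.146) p.101 (the slot); Balaban1989LargeFieldII, Thm 1 + (0.1) pp.355–356 (the record, bookkeeping)] -/
theorem exists_isRecordOfRecord₁₃CSepCoPHSB8subBP₂D_b8_of_leaf (θ : Stage13HParams F N) (h : θ.Provisos₁₃SepCoPH F N) (hθ : θ.Admissible F N)
    (lam : ResidB8 θ.toStage3Params) (hleaf : B8LeafOfRecordSubBP₂D θ.toStage3Params lam) {γw : ℝ} (hγ0 : 0 < γw) (hγ1 : γw ≤ θ.γ) :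
    ∃ w w' : WorldP, IsRecordOfRecord₁₃CSepCoPHSB8subBP₂D F N (datumOfRecord₁₃SepCoPH F N θ h) w ∧
      w.C = (datumOfRecord₁₃SepCoPH F N θ h).C ∧ w.γ = γw ∧ w.L = (θ.L : ℝ) ∧
      (∀ P : B12.RunParams, w.up P = upOfRecord₅CSC F N ((θ.pinB8SubBP₂D F N lam).toStage5₁₃CoPH F N) (c₇OfRecord θ.toStage3Params) P) ∧
      (∀ P : B12.RunParams, (leavesP w P).b8 ∧ Dag.B8_main (leavesP w P)) ∧
      IsRecordOfRecord₁₃CSepCoPH F N (datumOfRecord₁₃SepCoPH F N θ h) w' ∧ w'.C = w.C ∧ w'.γ = w.γ ∧ w'.L = w.L ∧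
      ∀ P : B12.RunParams, leavesP w P = { leavesP w' P with b8 := (leavesP w P).b8 } := by
  obtain ⟨w₀, -, -⟩ := exists_world_isRecordOfRecord₁₃CSepCoPH F N θ h hθ ⟨hγ0, hγ1⟩
  have hrec : IsRecordOfRecord₁₃CSepCoPHSB8subBP₂D F N (datumOfRecord₁₃SepCoPH F N θ h)
      { w₀ with
        C := (datumOfRecord₁₃SepCoPH F N θ h).C, γ := γw, L := (θ.L : ℝ), one_lt_L := by exact_mod_cast θ.hL.2,
        up := fun P => upOfRecord₅CSC F N ((θ.pinB8SubBP₂D F N lam).toStage5₁₃CoPH F N) (c₇OfRecord θ.toStage3Params) P } :=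
    ⟨θ, h, lam, hθ, rfl, rfl, ⟨hγ0, hγ1⟩, rfl, fun _ => rfl⟩
  obtain ⟨w', hw', hC', hγ', hL', hleaves, -⟩ := companion_of_isRecordOfRecord₁₃CSepCoPHSB8subBP₂D hrec
  refine ⟨_, w', hrec, rfl, rfl, rfl, fun _ => rfl, fun P => ?_, hw', hC', hγ', hL', hleaves⟩
  have hb8 : (upOfRecord₅CSC F N ((θ.pinB8SubBP₂D F N lam).toStage5₁₃CoPH F N) (c₇OfRecord θ.toStage3Params) P).b8 :=
    (upOfRecord₅CSC_toStage5₁₃CoPH_pinB8SubBP₂D_b8_iff F N θ lam P).2 hleaf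
  obtain ⟨h8iff, -, -⟩ := b8_b11_b10_main_iff_of_isRecordOfRecord₁₃CSepCoPHSB8subBP₂D hrec P
  exact ⟨hb8, h8iff.2 fun _ => hb8⟩

/-- **THE SLOT CLOSER, ∀-CURRENCY OVER THE MODULE'S RECORDS**: if the P₂D slot holds at EVERY admissible v1.7 package, `Dag.B8_main` holds at every run of every record of
`IsRecordOfRecord₁₃CSepCoPHSB8subBP₂D` (instance of `b8_main_of_isRecordOfRecord₁₃CSepCoPHSB8subBP₂D_of_slot`). [cite: Balaban1985RegularSpaces, Thm 8 (1.146) p.101 (bookkeeping)] -/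
theorem b8_main_at_isRecordOfRecord₁₃CSepCoPHSB8subBP₂D_of_forall_leaf
    (hB : ∀ (θ : Stage13HParams F N), θ.Provisos₁₃SepCoPH F N → θ.Admissible F N → ∀ lam : ResidB8 θ.toStage3Params, B8LeafOfRecordSubBP₂D θ.toStage3Params lam)
    {D : FiniteEpsData F (SU N)} {w : WorldP} (h : IsRecordOfRecord₁₃CSepCoPHSB8subBP₂D F N D w) (P : B12.RunParams) : Dag.B8_main (leavesP w P) :=
  b8_main_of_isRecordOfRecord₁₃CSepCoPHSB8subBP₂D_of_slot h (fun θ hP lam hθ _ _ => hB θ hP hθ lam) P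

end Slot

/-! ## §2. ★ N05 in ∃-currency at the v1.7-keyed «P₂D» record, FED BY THE RE-KEYED «P₂D» KNIT OF RECORD (Prop. 7 served; sockets at the (1.3)–(1.5)-admissible `Ω₀ = ℤᵈ` law members; `p5e p5u p6` displayed) -/

section Record

variable {F : T4Family} {N : ℕ} [NeZero N]

/-- ★ **N05 IN ∃-CURRENCY AT THE STAGE-13 RECORD OF RECORD — print's background (v1.7 key), «P₂D» pin, SC-binding, THEOREM 8 KNIT IN, PROPOSITION 7 SERVED**
(one-pin SC-bound record + same-datum `₁₃CSepCo` companion).  ADMISSIBLE Stage-13 parameters `θ` WITH v1.7 PROVISOS `h` and the inputs of dag-n05-d g12's re-keyed slot theorem of record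
`BalabanUVNodesN05SubBP2DSlotGammaPrime.b8LeafOfRecordSubBP₂D_cutSubB_of_knit_lettersSrc_γ'` (p618522, (10) of the «P₂D» wave) AT `θ.toStage3Params`, binder texts VERBATIM — record constants and Theorem 8's layer equations;
[4]'s letters (`SLet`, `SLetUB`), the sourceless b9 socket of Prop. 3's frame (`SB9P`, both-points Hölder edition) and the two SOURCED b9 sockets (`SH59src`, `SB9srcHP`) at the
(1.3)–(1.5)-ADMISSIBLE `Ω₀ = ℤᵈ` LAW members (`DomainSeq` ∧ dag-n05-c's (1.5) corner letter `∀ l < k, ∀ z ∈ Λs k l, Lˡ•z ∈ Lam L Ω l`) — HYPOTHESES; `p5e p5u` (Prop. 5 at an arbitrary family `lan`) and `p6` (Prop. 6 on the record's cube family at `c₁`) DISPLAYED — give, for every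
window `γw ∈ ]0, θ.γ]`, worlds `w w′` as in §1 at the CUT LAYER `λ.cutSubB J lan c₁`.  Proof: §1 ∘ p618522's slot theorem.  NOT a discharge of N05.
[cite: Balaban1985RegularSpaces, Lemma 1 p.79, Thm 2 p.83, Prop. 3 p.87, Thm 4 p.88, Prop. 7 p.100, Thm 8 (1.146) p.101 (knit in modulo the sockets); Prop. 5 (1.107)–(1.109) p.94, Prop. 6 (1.131)–(1.138) p.99 (named hypotheses); Balaban1985BackgroundPropagators, Thm 3.1 p.397, Thm 3.3 p.398 (letters and b9 sockets, hypotheses); Balaban1989LargeFieldII, Thm 1 + (0.1) pp.355–356 (the record, bookkeeping)] -/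
theorem exists_isRecordOfRecord₁₃CSepCoPHSB8subBP₂D_b8_of_knit_lettersSrc_γ' (θ : Stage13HParams F N) (h : θ.Provisos₁₃SepCoPH F N) (hθ : θ.Admissible F N)
    (lam : ResidB8 θ.toStage3Params) (hD : 2 ≤ θ.toStage3Params.D)
    {cB9 B₀'H B₂' BG BR cL : ℝ}
    (hC₂eq : lam.C₂ = 2097152 * ((θ.toStage3Params.D : ℝ) + 1) ^ 2 * (θ.toStage3Params.L : ℝ) ^ 2)
    (hcB9 : 0 < cB9) (hB₀'H : 0 < B₀'H) (hB₂' : 0 ≤ B₂') (hBG : 0 ≤ BG) (hBR : 0 ≤ BR) (hcL : 0 < cL)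
    -- [4]'s letters AT THE (1.3)–(1.5)-ADMISSIBLE `Ω₀ = ℤᵈ` LAW MEMBERS ONLY: existence side (laws on print's domains) and uniqueness side
    (SLet : ∀ i : ZdIdx θ.toStage3Params.D θ.toStage3Params.L, i.Ω 0 = Set.univ → IdxB8LawsB θ.toStage3Params.L i → B8ConstraintBonds.DomainSeq θ.toStage3Params.L i.Ω → (∀ l, l < i.k → ∀ z ∈ i.Λs i.k l, ((θ.toStage3Params.L : ℤ) ^ l) • z ∈ B8ConstraintBonds.Lam θ.toStage3Params.L i.Ω l) → SockLettersRD (𝔸 := θ.toStage3Params.𝔸) θ.toStage3Params.L BG BR B₀'H B₂' cL i.η i.k i.Ω i.Λs)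
    (SLetUB : ∀ i : ZdIdx θ.toStage3Params.D θ.toStage3Params.L, i.Ω 0 = Set.univ → IdxB8LawsB θ.toStage3Params.L i → B8ConstraintBonds.DomainSeq θ.toStage3Params.L i.Ω → (∀ l, l < i.k → ∀ z ∈ i.Λs i.k l, ((θ.toStage3Params.L : ℤ) ^ l) • z ∈ B8ConstraintBonds.Lam θ.toStage3Params.L i.Ω l) → ∀ α₀ : ℝ, 0 < α₀ → α₀ ≤ cL → ∀ U₀ : Site θ.toStage3Params.D → Fin θ.toStage3Params.D → θ.toStage3Params.𝔸ˣ, (∀ x κ, U₀ x κ ∈ unitaryUnits θ.toStage3Params.𝔸) →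
      InAk θ.toStage3Params.L i.k i.η α₀ i.Ω U₀ →
      ∃ (g Δ : (Site θ.toStage3Params.D → θ.toStage3Params.𝔸) →ₗ[ℂ] (Site θ.toStage3Params.D → θ.toStage3Params.𝔸)) (q : (Site θ.toStage3Params.D → θ.toStage3Params.𝔸) →ₗ[ℂ] (ℕ → Site θ.toStage3Params.D → θ.toStage3Params.𝔸))
        (qs : (ℕ → Site θ.toStage3Params.D → θ.toStage3Params.𝔸) →ₗ[ℂ] (Site θ.toStage3Params.D → θ.toStage3Params.𝔸)) (Aw c : (ℕ → Site θ.toStage3Params.D → θ.toStage3Params.𝔸) →ₗ[ℂ] (ℕ → Site θ.toStage3Params.D → θ.toStage3Params.𝔸))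
        (H' : XSpace θ.toStage3Params.D i.k θ.toStage3Params.𝔸 →ₗ[ℂ] (Site θ.toStage3Params.D → θ.toStage3Params.𝔸)),
        (∀ x : Site θ.toStage3Params.D → θ.toStage3Params.𝔸, (∃ C : ℝ, ∀ y, ‖x y‖ ≤ C) → g (Δ x + qs (Aw (q x))) = x) ∧ (∀ φ, qs (c (q (g (g (qs φ))))) = qs φ) ∧
        (∀ (f : Site θ.toStage3Params.D → θ.toStage3Params.𝔸), ∀ x ∈ i.Ω 0, Δ f x = covLap i.η U₀ ((i.Ω 0).indicator f) x) ∧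
        (∀ (μ : ℕ → Site θ.toStage3Params.D → θ.toStage3Params.𝔸), ∀ x ∈ i.Ω 0, qs μ x = QT θ.toStage3Params.L i.k (i.Λs i.k) U₀ μ x) ∧
        (∀ (f : Site θ.toStage3Params.D → θ.toStage3Params.𝔸) (n : ℕ), n ≤ i.k → ∀ y ∈ i.Λs i.k n, q f n y = QprimeIter (zdBlocking θ.toStage3Params.D θ.toStage3Params.L) (bgT θ.toStage3Params.L U₀) n f y) ∧
        (∀ (f : Site θ.toStage3Params.D → θ.toStage3Params.𝔸) (n : ℕ) (y : Site θ.toStage3Params.D), ¬ (n ≤ i.k ∧ y ∈ i.Λs i.k n) → q f n y = 0) ∧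
        (∀ (X : XSpace θ.toStage3Params.D i.k θ.toStage3Params.𝔸) (x : Site θ.toStage3Params.D), ‖H' X x‖ ≤ B₀'H * ‖X‖) ∧
        (∀ n, n ≤ i.k → ∀ (X : XSpace θ.toStage3Params.D i.k θ.toStage3Params.𝔸), ∀ p ∈ {b : Site θ.toStage3Params.D × Fin θ.toStage3Params.D | SideTouches (i.Ω n) b.1 b.2},
          wt θ.toStage3Params.L i.η n * ‖covDerivFwd i.η U₀ p.2 (H' X) p.1‖ ≤ B₀'H * ‖X‖) ∧
        (∀ X : XSpace θ.toStage3Params.D i.k θ.toStage3Params.𝔸, Bd2 θ.toStage3Params.L i.η i.k i.Ω (covLap i.η U₀ (H' X)) (B₂' * ‖X‖)) ∧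
        (∀ (Y : XSpace θ.toStage3Params.D i.k θ.toStage3Params.𝔸) (n : ℕ) (hn : n ≤ i.k) (y : Site θ.toStage3Params.D), y ∈ i.Λs i.k n →
          QprimeIter (zdBlocking θ.toStage3Params.D θ.toStage3Params.L) (bgT θ.toStage3Params.L U₀) n (H' Y) y = Y (⟨n, Nat.lt_succ_of_le hn⟩, y)) ∧
        (∀ (f : Site θ.toStage3Params.D → θ.toStage3Params.𝔸) (r : ℝ), 0 ≤ r → Bd2 θ.toStage3Params.L i.η i.k i.Ω f r →
          (∀ x, ‖g f x‖ ≤ BG * r) ∧ ∀ n, n ≤ i.k → ∀ p ∈ {b : Site θ.toStage3Params.D × Fin θ.toStage3Params.D | SideTouches (i.Ω n) b.1 b.2},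
            wt θ.toStage3Params.L i.η n * ‖covDerivFwd i.η U₀ p.2 (g f) p.1‖ ≤ BG * r) ∧
        (∀ (f : Site θ.toStage3Params.D → θ.toStage3Params.𝔸) (r : ℝ), 0 ≤ r → Bd2 θ.toStage3Params.L i.η i.k i.Ω f r → Bd2 θ.toStage3Params.L i.η i.k i.Ω (f - g (qs (c (q (g f))))) (BR * r)))
    -- the SOURCELESS b9 socket of Proposition 3's frame over PRINT's class, at the law members only ([4] Thm 3.3; threshold `cB9`) — for Prop. 3 AS PRINTED
    (SB9P : ∀ i : ZdIdx θ.toStage3Params.D θ.toStage3Params.L, i.Ω 0 = Set.univ → IdxB8LawsB θ.toStage3Params.L i → B8ConstraintBonds.DomainSeq θ.toStage3Params.L i.Ω → (∀ l, l < i.k → ∀ z ∈ i.Λs i.k l, ((θ.toStage3Params.L : ℤ) ^ l) • z ∈ B8ConstraintBonds.Lam θ.toStage3Params.L i.Ω l) →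
      SockB9P3H2 (𝔸 := θ.toStage3Params.𝔸) θ.toStage3Params.L lam.inp.B₀ lam.B₀β cB9 lam.β lam.len i.η i.k i.Ω i.Λs (fun m j => towerBondsP θ.toStage3Params.L i.Ω (i.Λs m) j))
    -- PROPOSITION 5 at an arbitrary family `lan`, PROPOSITION 6 on the record's cube family at `c₁` — DISPLAYED (Proposition 7 is SERVED below)
    {J : Type} {lan : J → B8.LandauData}
    (p5e : B8.Prop5Exists lam.inp.B₀' lam.B₁ lan) (p5u : B8.Prop5Unique lan)
    (c₁ : ℝ) (p6 : B8.Prop6Printed θ.toStage3Params.D (θ.toStage3Params.L : ℝ) lam.B₁ c₁ (fun j : IdxB8SubB θ.toStage3Params => cubB8OfRecord θ.toStage3Params j.1))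
    -- THEOREM 8's CONSTANTS, the layer equations, the sourced free-constant guard, the two SOURCED b9 sockets at the law members
    {c59 cP3 γ₈ γ' γ'' γβ B₈ B₈β : ℝ} (hc59 : 0 < c59) (hcP3 : 0 < cP3) (hγ₈ : 1 ≤ γ₈) (hγ' : 0 ≤ γ') (hγ'' : 0 ≤ γ'')
    (hB : 2 ≤ 5 * (θ.toStage3Params.D : ℝ) * θ.toStage3Params.L * lam.inp.B₀) (hB₀β : 0 < lam.B₀β) (hB₀8 : lam.inp.B₀ ≤ B₈)
    (hγB : 5 * (θ.toStage3Params.D : ℝ) * θ.toStage3Params.L * lam.inp.B₀ + 2 * (γ' * lam.inp.B₀) ≤ 5 * (θ.toStage3Params.D : ℝ) * θ.toStage3Params.L * B₈)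
    (hγB'' : 5 * (θ.toStage3Params.D : ℝ) * θ.toStage3Params.L * lam.inp.B₀ + 2 * (γ'' * lam.inp.B₀) ≤ 5 * (θ.toStage3Params.D : ℝ) * θ.toStage3Params.L * B₈)
    (hB8β : 5 * (θ.toStage3Params.D : ℝ) * θ.toStage3Params.L * lam.B₀β + 2 * lam.B₀β * (γ'' * lam.inp.B₀) + γβ ≤ 5 * (θ.toStage3Params.D : ℝ) * θ.toStage3Params.L * B₈β)
    (hB₁' : lam.B₁' = 5 * (θ.toStage3Params.D : ℝ) * θ.toStage3Params.L * B₈)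
    (hB₁eq : lam.B₁ = 5 * (θ.toStage3Params.D : ℝ) * θ.toStage3Params.L * B₈ * (1 + 11 * (θ.toStage3Params.D : ℝ) ^ 2)) (hB₂eq : lam.B₂ = 5 * (θ.toStage3Params.D : ℝ) * θ.toStage3Params.L * B₈β * (1 + 11 * (θ.toStage3Params.D : ℝ) ^ 2))
    (hfreeS : 3 * (2 * (θ.toStage3Params.D : ℝ) * (θ.toStage3Params.L : ℝ) ^ 2) * BG * BR * (B₈ + γ₈) ≤ lam.inp.B₀' * B₈)
    -- [Balaban1985BackgroundPropagators] Thm 3.3 WITH SOURCE in Theorem 4's frame at (1.146), γ′ letter, threshold `c59`, at the law members ONLY — HYPOTHESIS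
    (SH59src : ∀ i : ZdIdx θ.toStage3Params.D θ.toStage3Params.L, i.Ω 0 = Set.univ → IdxB8LawsB θ.toStage3Params.L i → B8ConstraintBonds.DomainSeq θ.toStage3Params.L i.Ω → (∀ l, l < i.k → ∀ z ∈ i.Λs i.k l, ((θ.toStage3Params.L : ℤ) ^ l) • z ∈ B8ConstraintBonds.Lam θ.toStage3Params.L i.Ω l) → ∀ α₀ α₁ : ℝ, 0 < α₀ → 0 < α₁ → α₀ + α₁ ≤ c59 →
      ∀ U₀ U' : Site θ.toStage3Params.D → Fin θ.toStage3Params.D → θ.toStage3Params.𝔸ˣ, (∀ x κ, U₀ x κ ∈ unitaryUnits θ.toStage3Params.𝔸) → (∀ x κ, U' x κ ∈ unitaryUnits θ.toStage3Params.𝔸) →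
      ∀ φ : Site θ.toStage3Params.D → θ.toStage3Params.𝔸, ((InR138 θ.toStage3Params.L i.k i.η (i.Ω 0) (i.Λs i.k) U₀ φ ∧ (∀ x, IsSelfAdjoint (φ x)) ∧ (∀ x, x ∉ i.Ω 0 → φ x = 0) ∧
          Bdd θ.toStage3Params.L i.k i.η (-(2 : ℝ)) (fun j (x : Site θ.toStage3Params.D) => x ∈ i.Ω j) φ) ∧
        msup θ.toStage3Params.L i.k i.η (-(2 : ℝ)) (fun j (x : Site θ.toStage3Params.D) => x ∈ i.Ω j) φ < γ₈ * (α₀ + α₁)) →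
      InAk θ.toStage3Params.L i.k i.η α₀ i.Ω U₀ → InAk θ.toStage3Params.L i.k i.η α₀ i.Ω (mulCfg U' U₀) → (∀ m, m ≤ i.k → InAx θ.toStage3Params.L m (i.Λs m) U₀ (mulCfg U' U₀)) →
      (∀ j, j ≤ i.k → ∀ (z : Site θ.toStage3Params.D) (μ : Fin θ.toStage3Params.D),
        ((∀ x, InBox (tlo θ.toStage3Params.L z j) (thi θ.toStage3Params.L z j) x → x ∈ i.Ω j) ∨ (∀ x, InBox (tlo θ.toStage3Params.L (z + e μ) j) (thi θ.toStage3Params.L (z + e μ) j) x → x ∈ i.Ω j)) →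
        ‖(avgIter θ.toStage3Params.L (mulCfg U' U₀) j z μ : θ.toStage3Params.𝔸) - (avgIter θ.toStage3Params.L U₀ j z μ : θ.toStage3Params.𝔸)‖ ≤ α₁) →
      (∀ b ∈ {b : Site θ.toStage3Params.D × Fin θ.toStage3Params.D | SideTouches (i.Ω 0) b.1 b.2}, ‖((U' b.1 b.2 : θ.toStage3Params.𝔸ˣ) : θ.toStage3Params.𝔸) - 1‖ ≤ α₁) →
      (∀ m, 1 ≤ m → m ≤ i.k → ∀ (u : Site θ.toStage3Params.D → θ.toStage3Params.𝔸ˣ) (W : Site θ.toStage3Params.D → Fin θ.toStage3Params.D → θ.toStage3Params.𝔸ˣ) (A' : Site θ.toStage3Params.D → Fin θ.toStage3Params.D → θ.toStage3Params.𝔸),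
        (∀ x, u x ∈ unitaryUnits θ.toStage3Params.𝔸) → mgauge U₀ u W = U' → Restr129 θ.toStage3Params.L m (i.Λs m) U₀ u → LanF146 θ.toStage3Params.L i.k i.η (i.Ω 0) i.Λs U₀ φ m W →
        (∀ y τ, IsSelfAdjoint (A' y τ)) →
        (∀ j, j ≤ m → ∀ y τ, SideTouches (i.Ω j) y τ →
        W y τ = cfgExp i.η A' y τ ∧ ‖A' y τ‖ ≤ (2 * (θ.toStage3Params.L * (5 * (θ.toStage3Params.D : ℝ) * θ.toStage3Params.L * B₈ * (α₀ + α₁))) + 8 * (8 * lam.inp.B₀' * (5 * (θ.toStage3Params.D : ℝ) * θ.toStage3Params.L * B₈) * (α₀ + α₁))) * ((θ.toStage3Params.L : ℝ) ^ j * i.η)⁻¹) →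
        (∀ y τ, (∀ j, j ≤ m → ¬ SideTouches (i.Ω j) y τ) → A' y τ = 0) →
        msup θ.toStage3Params.L m i.η (-(1 : ℝ)) (fun j (b : Site θ.toStage3Params.D × Fin θ.toStage3Params.D) => SideTouches (i.Ω j) b.1 b.2) (fun b => A' b.1 b.2)
        ≤ lam.inp.B₀ * (bondNorm θ.toStage3Params.L m i.η (-(3 : ℝ)) i.Ω (fun x μ => Jcur i.η U₀ A' μ x)
        + wsup 1 (fun p : {p : ℕ × (Site θ.toStage3Params.D × Fin θ.toStage3Params.D) // p.1 ≤ m ∧ p.2 ∈ towerBondsP θ.toStage3Params.L i.Ω (i.Λs m) p.1} =>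
        linCovIter θ.toStage3Params.L U₀ (iEta i.η A') p.1.1 p.1.2.1 p.1.2.2)) + γ' * lam.inp.B₀ * (α₀ + α₁) ∧
        msup θ.toStage3Params.L m i.η (-(2 : ℝ)) (fun j (t : Fin θ.toStage3Params.D × Fin θ.toStage3Params.D × Site θ.toStage3Params.D) => SideTouches (i.Ω j) t.2.2 t.2.1)
        (fun t => covDerivFwd i.η U₀ t.1 (fun z => A' z t.2.1) t.2.2)
        ≤ lam.inp.B₀ * (bondNorm θ.toStage3Params.L m i.η (-(3 : ℝ)) i.Ω (fun x μ => Jcur i.η U₀ A' μ x)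
        + wsup 1 (fun p : {p : ℕ × (Site θ.toStage3Params.D × Fin θ.toStage3Params.D) // p.1 ≤ m ∧ p.2 ∈ towerBondsP θ.toStage3Params.L i.Ω (i.Λs m) p.1} =>
        linCovIter θ.toStage3Params.L U₀ (iEta i.η A') p.1.1 p.1.2.1 p.1.2.2)) + γ' * lam.inp.B₀ * (α₀ + α₁)))
    -- THE SOURCED b9 SOCKET OF PROPOSITION 3's FRAME at the `Ω₀ = ℤᵈ` law members, threshold `cP3`, `|B₁|` over print's class at the top truncation — HYPOTHESIS
    -- ([Balaban1985BackgroundPropagators] Thm 3.3 with source; = `B8Prop3SrcZd3HPGamma`'s input letter for letter)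
    (SB9srcHP : ∀ i : ZdIdx θ.toStage3Params.D θ.toStage3Params.L, i.Ω 0 = Set.univ → IdxB8LawsB θ.toStage3Params.L i → B8ConstraintBonds.DomainSeq θ.toStage3Params.L i.Ω → (∀ l, l < i.k → ∀ z ∈ i.Λs i.k l, ((θ.toStage3Params.L : ℤ) ^ l) • z ∈ B8ConstraintBonds.Lam θ.toStage3Params.L i.Ω l) → ∀ α₀ α₁ α₂ : ℝ, 0 < α₀ → α₀ ≤ cP3 → 0 < α₁ → 0 < α₂ → α₂ ≤ cP3 →
      ∀ (U₀ W : Site θ.toStage3Params.D → Fin θ.toStage3Params.D → θ.toStage3Params.𝔸ˣ), (∀ x κ, U₀ x κ ∈ unitaryUnits θ.toStage3Params.𝔸) → (∀ x κ, W x κ ∈ unitaryUnits θ.toStage3Params.𝔸) →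
      ∀ f : Site θ.toStage3Params.D → θ.toStage3Params.𝔸, InR138 θ.toStage3Params.L i.k i.η (i.Ω 0) (i.Λs i.k) U₀ f →
      (∀ x, IsSelfAdjoint (f x)) → (∀ x, x ∉ i.Ω 0 → f x = 0) →
      Bdd θ.toStage3Params.L i.k i.η (-(2 : ℝ)) (fun j (x : Site θ.toStage3Params.D) => x ∈ i.Ω j) f →
      msup θ.toStage3Params.L i.k i.η (-(2 : ℝ)) (fun j (x : Site θ.toStage3Params.D) => x ∈ i.Ω j) f < γ₈ * (α₀ + α₁) →
      msup θ.toStage3Params.L i.k i.η (-(3 : ℝ)) (fun j (p : Fin θ.toStage3Params.D × Site θ.toStage3Params.D) => p.2 ∈ i.Ω j) (fun p => covDerivFwd i.η U₀ p.1 f p.2) < γ₈ * (α₀ + α₁) →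
      InAk θ.toStage3Params.L i.k i.η α₀ i.Ω U₀ → InAk θ.toStage3Params.L i.k i.η α₀ i.Ω (mulCfg W U₀) → IsLandau146W θ.toStage3Params.L i.k i.η (i.Ω 0) (i.Λs i.k) U₀ f W →
      ∀ A' : Site θ.toStage3Params.D → Fin θ.toStage3Params.D → θ.toStage3Params.𝔸, (∀ y τ, IsSelfAdjoint (A' y τ)) →
      (∀ j, j ≤ i.k → ∀ (y : Site θ.toStage3Params.D) (τ : Fin θ.toStage3Params.D), SideTouches (i.Ω j) y τ →
        W y τ = cfgExp i.η A' y τ ∧ ‖A' y τ‖ ≤ α₂ * ((θ.toStage3Params.L : ℝ) ^ j * i.η)⁻¹) →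
      (∀ (y : Site θ.toStage3Params.D) (τ : Fin θ.toStage3Params.D), (∀ j, j ≤ i.k → ¬ SideTouches (i.Ω j) y τ) → A' y τ = 0) →
      msup θ.toStage3Params.L i.k i.η (-(1 : ℝ)) (fun j (b : Site θ.toStage3Params.D × Fin θ.toStage3Params.D) => SideTouches (i.Ω j) b.1 b.2) (fun b => A' b.1 b.2)
          ≤ lam.inp.B₀ * (bondNorm θ.toStage3Params.L i.k i.η (-(3 : ℝ)) i.Ω (fun x μ => Jcur i.η U₀ A' μ x)
            + wsup 1 (fun p : {p : ℕ × (Site θ.toStage3Params.D × Fin θ.toStage3Params.D) // p.1 ≤ i.k ∧ p.2 ∈ towerBondsP θ.toStage3Params.L i.Ω (i.Λs i.k) p.1} =>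
                linCovIter θ.toStage3Params.L U₀ (iEta i.η A') p.1.1 p.1.2.1 p.1.2.2)) + γ'' * lam.inp.B₀ * (α₀ + α₁) ∧
        msup θ.toStage3Params.L i.k i.η (-(2 : ℝ)) (fun j (t : Fin θ.toStage3Params.D × Fin θ.toStage3Params.D × Site θ.toStage3Params.D) => SideTouches (i.Ω j) t.2.2 t.2.1)
            (fun t => covDerivFwd i.η U₀ t.1 (fun z => A' z t.2.1) t.2.2)
          ≤ lam.inp.B₀ * (bondNorm θ.toStage3Params.L i.k i.η (-(3 : ℝ)) i.Ω (fun x μ => Jcur i.η U₀ A' μ x)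
            + wsup 1 (fun p : {p : ℕ × (Site θ.toStage3Params.D × Fin θ.toStage3Params.D) // p.1 ≤ i.k ∧ p.2 ∈ towerBondsP θ.toStage3Params.L i.Ω (i.Λs i.k) p.1} =>
                linCovIter θ.toStage3Params.L U₀ (iEta i.η A') p.1.1 p.1.2.1 p.1.2.2)) + γ'' * lam.inp.B₀ * (α₀ + α₁) ∧
        bondNorm θ.toStage3Params.L i.k i.η (-(3 : ℝ)) i.Ω (fun x μ => pdiv i.η U₀ (plaqCovDeriv i.η U₀ A') μ x)
          ≤ lam.inp.B₀ * (bondNorm θ.toStage3Params.L i.k i.η (-(3 : ℝ)) i.Ω (fun x μ => Jcur i.η U₀ A' μ x)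
            + wsup 1 (fun p : {p : ℕ × (Site θ.toStage3Params.D × Fin θ.toStage3Params.D) // p.1 ≤ i.k ∧ p.2 ∈ towerBondsP θ.toStage3Params.L i.Ω (i.Λs i.k) p.1} =>
                linCovIter θ.toStage3Params.L U₀ (iEta i.η A') p.1.1 p.1.2.1 p.1.2.2)) + γ'' * lam.inp.B₀ * (α₀ + α₁) ∧
        bondNorm θ.toStage3Params.L i.k i.η (-(3 : ℝ)) i.Ω (fun x μ => covLap i.η U₀ (fun z => A' z μ) x)
          ≤ lam.inp.B₀ * (bondNorm θ.toStage3Params.L i.k i.η (-(3 : ℝ)) i.Ω (fun x μ => Jcur i.η U₀ A' μ x)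
            + wsup 1 (fun p : {p : ℕ × (Site θ.toStage3Params.D × Fin θ.toStage3Params.D) // p.1 ≤ i.k ∧ p.2 ∈ towerBondsP θ.toStage3Params.L i.Ω (i.Λs i.k) p.1} =>
                linCovIter θ.toStage3Params.L U₀ (iEta i.η A') p.1.1 p.1.2.1 p.1.2.2)) + γ'' * lam.inp.B₀ * (α₀ + α₁) ∧
        msup θ.toStage3Params.L i.k i.η (-(2 + lam.β)) (fun j (q : Fin θ.toStage3Params.D × Fin θ.toStage3Params.D × (Site θ.toStage3Params.D × Site θ.toStage3Params.D)) => q.2.2 ∈ AdmPair i.η lam.len ∧ q.2.2.1 ∈ i.Ω j ∧ q.2.2.2 ∈ i.Ω j)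
            (fun q => hquot i.η lam.β lam.len U₀ (covDerivFwd i.η U₀ q.1 (fun z => A' z q.2.1)) q.2.2)
          ≤ lam.B₀β * (bondNorm θ.toStage3Params.L i.k i.η (-(3 : ℝ)) i.Ω (fun x μ => Jcur i.η U₀ A' μ x)
            + wsup 1 (fun p : {p : ℕ × (Site θ.toStage3Params.D × Fin θ.toStage3Params.D) // p.1 ≤ i.k ∧ p.2 ∈ towerBondsP θ.toStage3Params.L i.Ω (i.Λs i.k) p.1} =>
                linCovIter θ.toStage3Params.L U₀ (iEta i.η A') p.1.1 p.1.2.1 p.1.2.2)) + γβ * (α₀ + α₁))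
    {γw : ℝ} (hγ0 : 0 < γw) (hγ1 : γw ≤ θ.γ) :
    ∃ w w' : WorldP, IsRecordOfRecord₁₃CSepCoPHSB8subBP₂D F N (datumOfRecord₁₃SepCoPH F N θ h) w ∧
      w.C = (datumOfRecord₁₃SepCoPH F N θ h).C ∧ w.γ = γw ∧ w.L = (θ.L : ℝ) ∧
      (∀ P : B12.RunParams, w.up P =
        upOfRecord₅CSC F N ((θ.pinB8SubBP₂D F N (lam.cutSubB J lan c₁)).toStage5₁₃CoPH F N) (c₇OfRecord θ.toStage3Params) P) ∧
      (∀ P : B12.RunParams, (leavesP w P).b8 ∧ Dag.B8_main (leavesP w P)) ∧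
      IsRecordOfRecord₁₃CSepCoPH F N (datumOfRecord₁₃SepCoPH F N θ h) w' ∧ w'.C = w.C ∧ w'.γ = w.γ ∧ w'.L = w.L ∧
      ∀ P : B12.RunParams, leavesP w P = { leavesP w' P with b8 := (leavesP w P).b8 } :=
  exists_isRecordOfRecord₁₃CSepCoPHSB8subBP₂D_b8_of_leaf θ h hθ _
    (b8LeafOfRecordSubBP₂D_cutSubB_of_knit_lettersSrc_γ' lam hD hC₂eq hcB9 hB₀'H hB₂' hBG hBR hcL SLet SLetUB SB9P p5e p5u c₁ p6 hc59 hcP3 hγ₈ hγ' hγ'' hB hB₀β hB₀8 hγB hγB'' hB8β hB₁' hB₁eq hB₂eq hfreeS SH59src SB9srcHP) hγ0 hγ1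

end Record

#print axioms exists_isRecordOfRecord₁₃CSepCoPHSB8subBP₂D_b8_of_leaf
#print axioms exists_isRecordOfRecord₁₃CSepCoPHSB8subBP₂D_b8_of_knit_lettersSrc_γ'

/-! ## §3. The slot closer in ∃λ-currency (the engine ∕ supplier row type «∃ λ, slot» ⇒ N05 in ∃-currency at the CoPH «P₂D» record + companion) -/

section ExistsSlot

variable {F : T4Family} {N : ℕ} [NeZero N]

/-- **THE SLOT CLOSER IN ∃λ-CURRENCY**: admissible `θ` with v1.7 provisos `h` and `∃ λ, B8LeafOfRecordSubBP₂D θ.toStage3Params λ` give, for every window `γw ∈ ]0, θ.γ]`,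
`∃ λ w w′` exactly as in §1 (record with SC-binding displayed, every run's `b8` + `Dag.B8_main`, same-datum companion).  One `obtain` + §1.  The ∃λ hypothesis is a HYPOTHESIS;
N05 NOT discharged. [cite: Balaban1985RegularSpaces, Thm 8 (1.146) p.101 (the slot); Balaban1989LargeFieldII, Thm 1 + (0.1) pp.355–356 (the record, bookkeeping)] -/
theorem exists_isRecordOfRecord₁₃CSepCoPHSB8subBP₂D_b8_of_exists_leaf (θ : Stage13HParams F N) (h : θ.Provisos₁₃SepCoPH F N) (hθ : θ.Admissible F N)
    (hslot : ∃ lam : ResidB8 θ.toStage3Params, B8LeafOfRecordSubBP₂D θ.toStage3Params lam) {γw : ℝ} (hγ0 : 0 < γw) (hγ1 : γw ≤ θ.γ) :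
    ∃ (lam : ResidB8 θ.toStage3Params) (w w' : WorldP), IsRecordOfRecord₁₃CSepCoPHSB8subBP₂D F N (datumOfRecord₁₃SepCoPH F N θ h) w ∧
      w.C = (datumOfRecord₁₃SepCoPH F N θ h).C ∧ w.γ = γw ∧ w.L = (θ.L : ℝ) ∧
      (∀ P : B12.RunParams, w.up P = upOfRecord₅CSC F N ((θ.pinB8SubBP₂D F N lam).toStage5₁₃CoPH F N) (c₇OfRecord θ.toStage3Params) P) ∧
      (∀ P : B12.RunParams, (leavesP w P).b8 ∧ Dag.B8_main (leavesP w P)) ∧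
      IsRecordOfRecord₁₃CSepCoPH F N (datumOfRecord₁₃SepCoPH F N θ h) w' ∧ w'.C = w.C ∧ w'.γ = w.γ ∧ w'.L = w.L ∧
      ∀ P : B12.RunParams, leavesP w P = { leavesP w' P with b8 := (leavesP w P).b8 } := by
  obtain ⟨lam, hleaf⟩ := hslot
  exact ⟨lam, exists_isRecordOfRecord₁₃CSepCoPHSB8subBP₂D_b8_of_leaf θ h hθ lam hleaf hγ0 hγ1⟩

/-- **N05 AT SOME RECORD OF THE MODULE, ∃λ-currency, world-level reading**: under the same hypotheses there is a record `w` of `IsRecordOfRecord₁₃CSepCoPHSB8subBP₂D` at `θ`'s datum,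
window `γw`, with the `b8` leaf and `Dag.B8_main (leavesP w P)` at every run (§3 with the binding and the companion forgotten) — hence, by width seat n05-w1 g2's membership
`Record13CarriersB8SubBP2DCoPHG.isRecordOfRecord₁₃CSepCoPHG_of_isRecordOfRecord₁₃CSepCoPHSB8subBP₂D` (announced, INTENT-8 (d)), a G-class record with N05 at every run.
[cite: Balaban1985RegularSpaces, Thm 8 (1.146) p.101 (bookkeeping)] -/
theorem exists_record_b8_main_of_exists_leaf (θ : Stage13HParams F N) (h : θ.Provisos₁₃SepCoPH F N) (hθ : θ.Admissible F N)
    (hslot : ∃ lam : ResidB8 θ.toStage3Params, B8LeafOfRecordSubBP₂D θ.toStage3Params lam) {γw : ℝ} (hγ0 : 0 < γw) (hγ1 : γw ≤ θ.γ) :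
    ∃ w : WorldP, IsRecordOfRecord₁₃CSepCoPHSB8subBP₂D F N (datumOfRecord₁₃SepCoPH F N θ h) w ∧ w.γ = γw ∧
      ∀ P : B12.RunParams, (leavesP w P).b8 ∧ Dag.B8_main (leavesP w P) := by
  obtain ⟨_, w, _, hw, -, hγ, -, -, hmain, -⟩ := exists_isRecordOfRecord₁₃CSepCoPHSB8subBP₂D_b8_of_exists_leaf θ h hθ hslot hγ0 hγ1
  exact ⟨w, hw, hγ, hmain⟩

end ExistsSlot

end Summit.QuantumFields.YangMills.BalabanUVNodes.N05AtRecord13SubBP2DSepCoPH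

end
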